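import Summits.NavierStokesRegularity.FluidComputer.BlockPairFlow

/-!
# Block design — the damped pair gate between the BOUNDED windows: the scaling obstruction
(bp3 gen 36)

HONEST FRAMING. Low prior, high value-of-information experiment on Tao's machine paradigm; NOT a
claim that NS blows up. DESIGN-LEVEL real analysis about the two-mode pair field `pairVF` of
`BlockPairStall`, its exact flow `pairFlow` (`BlockPairFlow`) and the energy bookkeeping of
`BlockRegulation` (`Passive`, `Delivers`, `Dat`, `withholding_law`) between the ORIGINAL bounded
windows `Ain P`, `Aout P` of `BlockReadout`. Nothing is asserted about Navier–Stokes.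

WHY. The owed re-typing of the residue (ASSEMBLY §2g.9(s): a Lipschitz / defect budget needs a
BOUNDED working region) has a LEVEL-FREE option: keep the bounded windows of `BlockReadout` and let
viscous damping REGULATE the amplitude (shed the fraction of the pair energy the `withholding_law`
demands). `BlockDegreeNoGo` does NOT speak to this (it concerns the LINEAR rotation-type field of
`BlockRegulationGate` only). This file records what does: SCALING.

WHAT IS PROVED (kernel-checked; [folklore] calculus and arithmetic).
1. `pair_energy_ge_exp`: along every orbit of `pairVF Λ₁ Λ₂ η k k'` with `Λ₁, Λ₂ ≤ Λ`, `η ≥ 0`,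
   the pair energy obeys `E(0) e^{-2Λt} ≤ E(t)`: the damped gate sheds AT MOST the fraction
   `1 − e^{-2Λτc}` of the pair energy per tick (for ANY `k, k'`).
2. `pairFlow_passive`, `pairFlow_delivers`: the exact flow is `Passive … 0` and
   `Delivers … (1 − e^{-2Λτc})` in the sense of `BlockRegulation`.
3. `pairFlow_withholding`: if the flow inhabits `Dat P … τc δsh` (`δsh ≥ 0`) then
   `e^{-2Λτc} (aHi + δ)² − σsp² ≤ ((aLo − δ) aHi / aLo)²` (`withholding_law` at margin `0`).
4. `pairFlow_not_dat_reg`: for `Params.reg` (`aLo = 3/2`, `aHi = 2`, `δ = 1/20`, `σsp = 1/4`;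
   any `η ≥ 1/2`) NO damped pair gate with `Λ τc ≤ 1/25` inhabits `Dat`, whatever `k, k', δsh ≥ 0`.
5. `dampingAt Λ₀ η n = Λ₀ (2η)^{-n/2}` — the block-unit damping at level `n` under the dimensional
   tick (DICTIONARY below): level-free at `η = 1/2` (`dampingAt_half`), tending to `0` for `η > 1/2`
   (`tendsto_dampingAt`); hence 6. `eventually_not_dat_reg`: for `η > 1/2`, every `Λ₀` and every
   tick length `τc > 0` there is a level beyond which no damped pair gate with block-unit dampings
   `≤ dampingAt Λ₀ η n` inhabits `Dat` between the level-free bounded windows `Params.reg`.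

DICTIONARY (design-level, definitional; [cite: Tao2016AveragedNS, §6 (6.6)] for the tick). Mode
`n` is damped at the physical rate `ν λ_n²`; in the units of block `n`, whose tick is the
dimensional time `T_n = c λ_n^{-5/2} E_n^{-1/2}` of `Literature…SpecArithmetic` (`dimensionalTime`;
`= C' (2^{-α_eff})ⁿ`, `2^{-α_eff} = 2^{-5/2} η^{-1/2}`, `dimensionalTime_eq_geometric`,
`two_rpow_neg_alphaEff`), the damping number is `Λ₁⁽ⁿ⁾ = ν λ_n² T_n = Λ₀ (4 · 2^{-5/2} η^{-1/2})ⁿ =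
Λ₀ (2η)^{-n/2} = dampingAt Λ₀ η n`, and `Λ₂⁽ⁿ⁾ = 4 Λ₁⁽ⁿ⁾` (the output mode has twice the
frequency). So the block-unit damping is LEVEL-FREE iff `η = 1/2` iff `α_eff = 2`
(`two_le_alphaEff_iff` with equality): the NS-scaling-invariant, discretely self-similar cascade.

HONEST READING (for ASSEMBLY §2g.9(s) (γ) / R1-DESIGN §25.13).
(a) WHAT IT CLOSES, AND WHY. Regulation by viscous damping between LEVEL-FREE bounded windows needs
a level-free shed fraction (`withholding_law`: `> 9.5%` per tick on `Params.reg`), but for every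
viscosity-admissible efficiency `η > 1/2` the available damping `dampingAt Λ₀ η n → 0`: items 4–6
close this option AT DEPTH for the whole damped two-mode family (every `k, k'`), by scaling alone.
The design trilemma's option (T2) is therefore closed for `η > 1/2` — by THIS, not by
`BlockDegreeNoGo` (R1-DESIGN §25.10 (iv) cited the wrong reason; corrected in §25.13).
(b) THE BOUNDARY `η = 1/2` is the CORNER of ASSEMBLY §2h / `Literature…TypeOneNumber`
(`corner_iff_of_closure`: Type-I rate, the NS-scaling discretely self-similar cascade; constant
viscous number — the quantity `ν λ_n² T_n` of `typeOne_viscous_reciprocity`, given in closed form by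
`viscous_eq_dampingAt` here), where the classical self-similar / Type-I exclusions live
(Nečas–Růžička–Šverák, Tsai, Chae, Chae–Wolf, §2h item 5, each under profile hypotheses); §2h
reads the corner as essentially closed. The endpoint criterion adds only CONSISTENCY there: under
the one-scale Bernstein dictionary of §2h a clean level-`n` state has `L³` size
`≍ (|a| + |b|) √E₀ (2η)^{n/2}` (up to `λ₀^{1/2}`), so the `L³` norm along the cascade blows up
geometrically for `η > 1/2` and, at the corner, logarithmically — like `n^{1/3}`, carried by the
unerased spent levels of equal `L³` size — as it must along any blow-up
[cite: EscauriazaSereginSverak2003, Thms. 1.3–1.4], [cite: Seregin2012CMP, Thm. 1.1], and far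
faster than the triple-logarithmic rate that is forced [cite: Tao2021QuantitativeNS, Thm. 1.4]; no
exclusion follows from it.
So regulation by dissipation between level-free bounded windows is available exactly where the
machine paradigm cannot live. For the record only — to make plain that the obstruction is the
SCALING and not the gate — INDICATIVE floating-point numerics (uncertified;
`g36/numerics/regulate36.py`: `η = 1/2`, `Λ₂ = 4Λ₁ ∈ [0.6, 0.8]`, `k ∈ {6, 8, 12}`, `τc = 1`) find
that at level-free damping EVERY input of the closed bounded window hands off into
`Aout (Params.reg)` with margin `1/50` by `t ≤ 0.74` (a SLIDING hand-off: after the transfer the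
output amplitude decays through the window while the input stays spent). Neither (a) nor (b) is a
theorem about NS: (a) is design arithmetic, (b) a cited dictionary. What remains are the
level-INDEXED bounded windows (T1) and the open windows with a changed residue (T3) of R1-DESIGN
§25.10; and (a) says the (T1) blocks at depth are the UNDAMPED gate up to a perturbation of size
`dampingAt Λ₀ η n → 0`.
-/

noncomputable section

open Set Filter Topology Metric

namespace Summit.NavierStokesRegularity.FluidComputer

open Literature.Analysis.FluidPDE Literature.Analysis.FluidPDE.FluidComputer

namespace BlockDesign

/-! ## 1. The exponential energy floor along damped orbits -/

section Floor

variable {Λ₁ Λ₂ Λ η k k' T : ℝ} {z : ℝ → ℝ × ℝ}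

/-- ENERGY FLOOR: along an orbit of `pairVF Λ₁ Λ₂ η k k'` on `[0, T]` with `Λ₁, Λ₂ ≤ Λ` and
`η ≥ 0`, `E(0) e^{-2Λt} ≤ E(t)` (`E = pairEnergy η`): since `dE/dt = -2(Λ₁ a² + η Λ₂ b²) ≥ -2Λ E`
(`pairVF_energy`). The gate sheds at most the fraction `1 - e^{-2ΛT}` per tick. [folklore] -/
theorem pair_energy_ge_exp (h₁ : Λ₁ ≤ Λ) (h₂ : Λ₂ ≤ Λ) (hη : 0 ≤ η)
    (hcont : ContinuousOn z (Icc 0 T))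
    (hderiv : ∀ t ∈ Ico 0 T, HasDerivWithinAt z (pairVF Λ₁ Λ₂ η k k' (z t)) (Ici t) t) :
    ∀ t ∈ Icc 0 T, pairEnergy η (z 0) * Real.exp (-(2 * Λ) * t) ≤ pairEnergy η (z t) := by
  -- `φ(t) = E(t) e^{2Λt}` has right derivative `e^{2Λt} (E' + 2Λ E) ≥ 0`; compare `-φ` with the
  -- constant `-E(0)` (`image_le_of_deriv_right_le_deriv_boundary`).
  have hg : ∀ s, HasDerivAt (fun t => Real.exp (2 * Λ * t)) (Real.exp (2 * Λ * s) * (2 * Λ)) s :=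
    fun s => (hasDerivAt_const_mul (2 * Λ : ℝ)).exp
  have hf : ContinuousOn (fun t => -(pairEnergy η (z t) * Real.exp (2 * Λ * t))) (Icc 0 T) :=
    ((continuousOn_pairEnergy_comp hcont η).mul
      fun s _ => (hg s).continuousAt.continuousWithinAt).neg
  have hf' := fun x (hx : x ∈ Ico 0 T) =>
    ((hasDerivWithinAt_pairEnergy_comp (hderiv x hx) η).mul (hg x).hasDerivWithinAt).neg
  intro t ht
  have key := image_le_of_deriv_right_le_deriv_boundary hf hf'
    (B := fun _ => -pairEnergy η (z 0)) (B' := fun _ => 0)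
    (by
      show -(pairEnergy η (z 0) * Real.exp (2 * Λ * 0)) ≤ -pairEnergy η (z 0)
      rw [mul_zero, Real.exp_zero, mul_one])
    (fun _ _ => continuousWithinAt_const) (fun _ _ => hasDerivWithinAt_const _ _ _)
    (fun s _ => by
      rw [pairVF_energy]
      have hE : pairEnergy η (z s) = (z s).1 ^ 2 + η * (z s).2 ^ 2 := rfl
      have hpos : 0 < Real.exp (2 * Λ * s) := Real.exp_pos _
      have hin : 0 ≤ 2 * Λ * ((z s).1 ^ 2 + η * (z s).2 ^ 2)
          - 2 * (Λ₁ * (z s).1 ^ 2 + η * Λ₂ * (z s).2 ^ 2) := by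
        nlinarith [mul_le_mul_of_nonneg_right h₁ (sq_nonneg (z s).1),
          mul_le_mul_of_nonneg_right h₂ (mul_nonneg hη (sq_nonneg (z s).2))]
      rw [hE]
      nlinarith [mul_nonneg hpos.le hin]) ht
  have hk : pairEnergy η (z 0) ≤ pairEnergy η (z t) * Real.exp (2 * Λ * t) := by linarith [key]
  have hexp : Real.exp (2 * Λ * t) * Real.exp (-(2 * Λ) * t) = 1 := by
    rw [← Real.exp_add, show 2 * Λ * t + -(2 * Λ) * t = 0 by ring, Real.exp_zero]
  calc pairEnergy η (z 0) * Real.exp (-(2 * Λ) * t)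
      ≤ pairEnergy η (z t) * Real.exp (2 * Λ * t) * Real.exp (-(2 * Λ) * t) :=
        mul_le_mul_of_nonneg_right hk (Real.exp_pos _).le
    _ = pairEnergy η (z t) := by rw [mul_assoc, hexp, mul_one]

end Floor

/-! ## 2. The damped pair gate in the bookkeeping of `BlockRegulation` -/

section Gate

variable {S : CascadeSpecs} (P : Params S)
variable {Λ₁ Λ₂ Λ τc : ℝ}

/-- The damped pair gate (exact flow `pairFlow` of `BlockPairFlow`, `η = S.eta`) is PASSIVE with
slack `0`: the pair energy never increases (`pair_energy_le`). [folklore] -/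
theorem pairFlow_passive (hΛ₁ : 0 ≤ Λ₁) (hΛ₂ : 0 ≤ Λ₂) (k k' : ℝ) (hτ : 0 < τc) :
    Passive P (pairFlow hΛ₁ hΛ₂ S.eta_pos k k' hτ) τc 0 := by
  intro p _ σ h0 h1
  have h := pair_energy_le hΛ₁ hΛ₂ S.eta_pos.le
    (continuousOn_pairFlow hΛ₁ hΛ₂ S.eta_pos k k' hτ p)
    (hasDerivWithinAt_pairFlow hΛ₁ hΛ₂ S.eta_pos k k' hτ p) σ ⟨h0, h1⟩
  rw [pairFlow_zero] at h
  linarith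

/-- The damped pair gate DELIVERS with withholding `1 - e^{-2Λτc}` when `Λ₁, Λ₂ ≤ Λ`: the pair
energy never drops below `e^{-2Λτc}` of its initial value during the tick. [folklore] -/
theorem pairFlow_delivers (hΛ₁ : 0 ≤ Λ₁) (hΛ₂ : 0 ≤ Λ₂) (h₁ : Λ₁ ≤ Λ) (h₂ : Λ₂ ≤ Λ) (k k' : ℝ)
    (hτ : 0 < τc) :
    Delivers P (pairFlow hΛ₁ hΛ₂ S.eta_pos k k' hτ) τc (1 - Real.exp (-(2 * Λ) * τc)) := by
  intro p _ σ h0 h1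
  have h := pair_energy_ge_exp h₁ h₂ S.eta_pos.le
    (continuousOn_pairFlow hΛ₁ hΛ₂ S.eta_pos k k' hτ p)
    (hasDerivWithinAt_pairFlow hΛ₁ hΛ₂ S.eta_pos k k' hτ p) σ ⟨h0, h1⟩
  rw [pairFlow_zero] at h
  have hΛ : 0 ≤ Λ := hΛ₁.trans h₁
  have hmono : Real.exp (-(2 * Λ) * τc) ≤ Real.exp (-(2 * Λ) * σ) :=
    Real.exp_le_exp.mpr (by nlinarith)
  have hE : 0 ≤ pairEnergy S.eta p := pairEnergy_nonneg S.eta_pos.le p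
  calc (1 - (1 - Real.exp (-(2 * Λ) * τc))) * pairEnergy S.eta p
      = pairEnergy S.eta p * Real.exp (-(2 * Λ) * τc) := by ring
    _ ≤ pairEnergy S.eta p * Real.exp (-(2 * Λ) * σ) := mul_le_mul_of_nonneg_left hmono hE
    _ ≤ _ := h

/-- `Dat` with a nonnegative margin implies `Dat` with margin `0`. [folklore] -/
theorem Dat.of_margin {Φ : ℝ → ℝ × ℝ → ℝ × ℝ} {τc δsh : ℝ} (hδ : 0 ≤ δsh) (hD : Dat P Φ τc δsh) :
    Dat P Φ τc 0 := by
  intro p hp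
  obtain ⟨σ, h0, h1, hball⟩ := hD p hp
  exact ⟨σ, h0, h1, (Metric.closedBall_subset_closedBall hδ).trans hball⟩

/-- WITHHOLDING for the damped pair gate: if its flow inhabits `Dat P … τc δsh` (`δsh ≥ 0`,
`Λ₁, Λ₂ ≤ Λ`) then `e^{-2Λτc} (aHi + δ)² − σsp² ≤ ((aLo − δ) aHi / aLo)²` — `withholding_law` of
`BlockRegulation` at margin `0` with `1 − r = e^{-2Λτc}`. [folklore] -/
theorem pairFlow_withholding (hΛ₁ : 0 ≤ Λ₁) (hΛ₂ : 0 ≤ Λ₂) (h₁ : Λ₁ ≤ Λ) (h₂ : Λ₂ ≤ Λ)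
    (k k' : ℝ) (hτ : 0 < τc) {δsh : ℝ} (hδ : 0 ≤ δsh)
    (hD : Dat P (pairFlow hΛ₁ hΛ₂ S.eta_pos k k' hτ) τc δsh) :
    Real.exp (-(2 * Λ) * τc) * (P.aHi + P.δ) ^ 2 - P.σsp ^ 2 ≤
      ((P.aLo - P.δ) * P.aHi / P.aLo) ^ 2 := by
  have hw := withholding_law P le_rfl (r := 1 - Real.exp (-(2 * Λ) * τc))
    (by linarith [Real.exp_pos (-(2 * Λ) * τc)]) (pairFlow_passive P hΛ₁ hΛ₂ k k' hτ)
    (pairFlow_delivers P hΛ₁ hΛ₂ h₁ h₂ k k' hτ) (Dat.of_margin P hδ hD)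
  simp only [sub_sub_cancel, sub_zero, add_zero] at hw
  exact hw

/-- NO REGULATION WITH SMALL DAMPING on `Params.reg` (`aLo = 3/2`, `aHi = 2`, `δ = 1/20`,
`σsp = 1/4`; any `η ≥ 1/2`): if `Λ₁, Λ₂ ≤ Λ` and `Λ τc ≤ 1/25` then the damped pair gate does NOT
inhabit `Dat` for any `k, k'` and any margin `δsh ≥ 0` — it cannot shed the `> 9.5%` of the pair
energy the withholding law demands (`e^{-2Λτc} ≥ 1 − 2Λτc ≥ 23/25`). [folklore] -/
theorem pairFlow_not_dat_reg (hS : S.lam0 = 1) (hη : 1 / 2 ≤ S.eta) (hΛ₁ : 0 ≤ Λ₁) (hΛ₂ : 0 ≤ Λ₂)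
    (h₁ : Λ₁ ≤ Λ) (h₂ : Λ₂ ≤ Λ) (k k' : ℝ) (hτ : 0 < τc) (hsmall : Λ * τc ≤ 1 / 25) {δsh : ℝ}
    (hδ : 0 ≤ δsh) : ¬ Dat (Params.reg S hS hη) (pairFlow hΛ₁ hΛ₂ S.eta_pos k k' hτ) τc δsh := by
  intro hD
  have hw := pairFlow_withholding (Params.reg S hS hη) hΛ₁ hΛ₂ h₁ h₂ k k' hτ hδ hD
  have hexp : 1 - 2 * Λ * τc ≤ Real.exp (-(2 * Λ) * τc) := by
    have := Real.add_one_le_exp (-(2 * Λ) * τc)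
    linarith
  have he : (23 : ℝ) / 25 ≤ Real.exp (-(2 * Λ) * τc) := by linarith
  simp only [Params.reg] at hw
  nlinarith

end Gate

/-! ## 3. The scaling dictionary: block-unit damping along the cascade -/

section Scaling

/-- Block-unit damping number of the input mode at level `n` under the dimensional tick:
`Λ₀ (2η)^{-n/2}` (DICTIONARY in the module docstring; the output mode carries `4×` this).
[folklore] -/
def dampingAt (Λ₀ η : ℝ) (n : ℕ) : ℝ := Λ₀ * (Real.sqrt (2 * η))⁻¹ ^ n

/-- At the critical efficiency `η = 1/2` the block-unit damping is LEVEL-FREE. [folklore] -/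
theorem dampingAt_half (Λ₀ : ℝ) (n : ℕ) : dampingAt Λ₀ (1 / 2) n = Λ₀ := by
  simp [dampingAt]

/-- One level down the cascade the damping number is divided by `√(2η)`. [folklore] -/
theorem dampingAt_succ (Λ₀ η : ℝ) (n : ℕ) :
    dampingAt Λ₀ η (n + 1) = dampingAt Λ₀ η n * (Real.sqrt (2 * η))⁻¹ := by
  simp only [dampingAt, pow_succ]; ring

/-- `dampingAt Λ₀ η n ≥ 0` for `Λ₀ ≥ 0`. [folklore] -/
theorem dampingAt_nonneg {Λ₀ : ℝ} (hΛ₀ : 0 ≤ Λ₀) (η : ℝ) (n : ℕ) : 0 ≤ dampingAt Λ₀ η n :=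
  mul_nonneg hΛ₀ (pow_nonneg (inv_nonneg.mpr (Real.sqrt_nonneg _)) n)

/-- For every viscosity-admissible efficiency ABOVE the critical one, `η > 1/2`, the block-unit
damping tends to `0` along the cascade (the cascade is genuinely supercritical). [folklore] -/
theorem tendsto_dampingAt {η : ℝ} (hη : 1 / 2 < η) (Λ₀ : ℝ) :
    Tendsto (dampingAt Λ₀ η) atTop (𝓝 0) := by
  have h1 : 1 < Real.sqrt (2 * η) := by
    rw [show (1 : ℝ) = Real.sqrt 1 from Real.sqrt_one.symm]
    exact Real.sqrt_lt_sqrt zero_le_one (by linarith)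
  have h2 : (Real.sqrt (2 * η))⁻¹ < 1 := inv_lt_one_of_one_lt₀ h1
  have h3 : 0 ≤ (Real.sqrt (2 * η))⁻¹ := inv_nonneg.mpr (Real.sqrt_nonneg _)
  have h := (tendsto_pow_atTop_nhds_zero_of_lt_one h3 h2).const_mul Λ₀
  rw [mul_zero] at h
  exact h

/-- The dimensional tick of `SpecArithmetic` shrinks by the factor `2^{-α_eff} = 2^{-5/2} η^{-1/2}`
per level (`dimensionalTime_eq_geometric`, `two_rpow_neg_alphaEff`). [folklore] -/
theorem dimensionalTime_succ (S : CascadeSpecs) (c : ℝ) (n : ℕ) :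
    S.dimensionalTime c (n + 1) =
      S.dimensionalTime c n * ((2 : ℝ) ^ (-(5 / 2 : ℝ)) * S.eta ^ (-(1 / 2 : ℝ))) := by
  rw [S.dimensionalTime_eq_geometric, S.dimensionalTime_eq_geometric, pow_succ,
    S.two_rpow_neg_alphaEff]
  ring

/-- DICTIONARY CHECK: `ν λ_n² T_n`, with `T_n` the dimensional tick of `SpecArithmetic`, obeys the
recursion of `dampingAt` (`dampingAt_succ`): one level multiplies `λ²` by `4` and the tick by
`2^{-5/2} η^{-1/2}`, and `4 · 2^{-5/2} η^{-1/2} = 1/√(2η)`. Hence `ν λ_n² T_n = dampingAt (ν λ₀² T₀)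
η n` by induction (`viscous_eq_dampingAt`). [folklore] -/
theorem viscous_succ (S : CascadeSpecs) (ν c : ℝ) (n : ℕ) :
    ν * S.lam (n + 1) ^ 2 * S.dimensionalTime c (n + 1) =
      ν * S.lam n ^ 2 * S.dimensionalTime c n * (Real.sqrt (2 * S.eta))⁻¹ := by
  rw [S.lam_succ, dimensionalTime_succ]
  have h52 : (2 : ℝ) ^ (5 / 2 : ℝ) = 4 * Real.sqrt 2 := by
    rw [show (5 / 2 : ℝ) = 2 + 1 / 2 by norm_num, Real.rpow_add two_pos, Real.rpow_two,
      ← Real.sqrt_eq_rpow]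
    norm_num
  have h2 : (2 : ℝ) ^ (-(5 / 2 : ℝ)) = (Real.sqrt 2)⁻¹ / 4 := by
    rw [Real.rpow_neg zero_le_two, h52, mul_inv]
    ring
  have hη : S.eta ^ (-(1 / 2 : ℝ)) = (Real.sqrt S.eta)⁻¹ := by
    rw [Real.rpow_neg S.eta_pos.le, ← Real.sqrt_eq_rpow]
  rw [h2, hη, Real.sqrt_mul' 2 S.eta_pos.le, mul_inv]
  ring

/-- THE DICTIONARY AS AN IDENTITY: the block-unit damping of mode `n` under the dimensional tick is
`dampingAt (ν λ₀² T₀) η n = Λ₀ (2η)^{-n/2}`. [folklore] -/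
theorem viscous_eq_dampingAt (S : CascadeSpecs) (ν c : ℝ) (n : ℕ) :
    ν * S.lam n ^ 2 * S.dimensionalTime c n =
      dampingAt (ν * S.lam 0 ^ 2 * S.dimensionalTime c 0) S.eta n := by
  induction n with
  | zero => simp [dampingAt]
  | succ n ih => rw [viscous_succ, ih, dampingAt_succ]

/-- THE OBSTRUCTION AT DEPTH: for `η > 1/2`, every `Λ₀` and every tick length `τc > 0` there
is a level `N` such that at all levels `n ≥ N` NO damped pair gate whose block-unit dampings are
at most `dampingAt Λ₀ η n` (any `k, k'`, any margin `δsh ≥ 0`) inhabits `Dat` between the level-free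
bounded windows `Params.reg`. (At `η = 1/2` the hypothesis `1/2 < η` fails and `dampingAt` is
constant: nothing is claimed.) [folklore] -/
theorem eventually_not_dat_reg {S : CascadeSpecs} (hS : S.lam0 = 1) (hη : 1 / 2 < S.eta)
    {Λ₀ τc : ℝ} (hτ : 0 < τc) :
    ∃ N : ℕ, ∀ n, N ≤ n → ∀ (Λ₁ Λ₂ k k' δsh : ℝ) (hΛ₁ : 0 ≤ Λ₁) (hΛ₂ : 0 ≤ Λ₂),
      Λ₁ ≤ dampingAt Λ₀ S.eta n → Λ₂ ≤ dampingAt Λ₀ S.eta n → 0 ≤ δsh →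
        ¬ Dat (Params.reg S hS hη.le) (pairFlow hΛ₁ hΛ₂ S.eta_pos k k' hτ) τc δsh := by
  have hev : ∀ᶠ n in atTop, dampingAt Λ₀ S.eta n < 1 / 25 / τc :=
    (tendsto_dampingAt hη Λ₀).eventually (gt_mem_nhds (by positivity))
  obtain ⟨N, hN⟩ := hev.exists_forall_of_atTop
  refine ⟨N, fun n hn Λ₁ Λ₂ k k' δsh hΛ₁ hΛ₂ h₁ h₂ hδ => ?_⟩
  have hlt := hN n hn
  have hsmall : dampingAt Λ₀ S.eta n * τc ≤ 1 / 25 := by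
    rw [lt_div_iff₀ hτ] at hlt
    exact hlt.le
  exact pairFlow_not_dat_reg hS hη.le hΛ₁ hΛ₂ h₁ h₂ k k' hτ hsmall hδ

end Scaling

end BlockDesign

end Summit.NavierStokesRegularity.FluidComputer
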